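import Literature.NumberTheory.EllipticCurves.BDPAnticyclotomicPAdicLFunctionHigherWeight
import Literature.NumberTheory.EllipticCurves.AnticyclotomicRankinSelbergPAdicLFunction
import HarnessLib

/-!
# The Σ-IMPRIMITIVE anticyclotomic `p`-adic `L`-function of a weight-`k` cusp form, characterised by interpolation of
# Σ-depleted central values, in the wide receptacle `𝓞_{ℂ_p}⟦T⟧` (`IsBDPLFunctionWtSigmaInt`)

Trunk T-NT-EC (`Literature/NumberTheory/EllipticCurves`). Cell `bsd-stepL` (run/shared/lean/pub/bsd-stepL/), seat
`bsd-stepL-imc-p1` (prover g15, 2026-08-28); design memo `HOME/imc-p1/g15/FSPLIT-DESIGN-20529-imc-p1-g15.md` (evidence on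
item stmt-BirchSwinnertonDyer-20529), item D-a′. DEFINITIONS with bodies and proved API; no named fact, no `sorry`, no instance,
no notation.

## Why

The erratum's member package (tree `Castella2018.erratum_members_exists_charIdeal_le_of_isTorsion_congruence_OPEN`, K2 crux
`CastellaErratumMemberPackage`) keeps the member's `L^Σ_p(g_m)` EXISTENTIAL (flag `Mem-r3`): the tree's weight-`k` frame
`IsBDPLFunctionWt ι 𝔭 κ γ g ΩK Ωp (L : UnrSeries p)` (`BDPAnticyclotomicPAdicLFunctionHigherWeight.lean`, D3) is `R₀⟦T⟧`-valued and
cannot host `L_p(g_m)` when the member's coefficient ring `𝒪_m ⊄ R₀`, and it is PRIMITIVE (no `Σ`). To state the erratum's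
Thm. 2.3 «⊂» — `Ch_{Λ_𝒪}(X^Σ_ac(A_g))Λ_𝒪^ur ⊂ (L^Σ_p(g))`, [Cas18 (3.1)]: `L^Σ_p := L_p × ∏_{w∈Σ} P_w(εΨ⁻¹(γ_w))` — for ONE newform `g`
with a DEFINITE `L^Σ_p(g)`, this file provides the characterising predicate in the receptacle `𝓞_{ℂ_p}⟦T⟧ ⊇ R₀⟦T⟧, 𝒪_m⟦T⟧`
(the currency of the tree's `IntSeries.HasValueAt` and of `R1.IsBDPLFunctionInt`), and makes it Σ-IMPRIMITIVE by interpolating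
Σ-DEPLETED values, exactly as [JSW17, §5.1] characterises `L^Σ_p(f)`: "`L^Σ_p(f) = L_p(f) × ∏_{w∈Σ} P_w(ε⁻¹Ψ⁻¹(Frob_w))` … Then
`L^Σ_p(f,ψ) := ψ̂(L^Σ_p(f))` satisfies the interpolation formula (Lp-interp) but with `L(f,ψ^alg,1)` replaced with the incomplete
`L`-value `L^Σ(f,ψ^alg,1)`" (arXiv:1512.06894 tex p0022 L41–50) — so NO Euler element of `g` over `K_∞` has to be named.

## Contents

* §1 `rankinSelbergValueHeckeWtSigma g φ Σ s₀ := L(g/K, φ, s₀) · ∏_{v∈Σ} (inverse local factor at v)(s₀)` — the Σ-depleted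
  (incomplete) value `L^Σ(g/K, φ, s₀)` (the tree's `rankinSelbergValueHeckeWt` times the tree's `rankinSelbergLocalFactorInvHeckeWt`
  at the places of `Σ`); `_empty`.
* §2 `bdpInterpolationValueWtSigma p g 𝔭 φ Σ n ΩK` — VERBATIM `bdpInterpolationValueWt` (Castella–Hsieh Prop. 3.8 in Castella's
  normalisation, D3) with the central value replaced by the Σ-depleted one; `_empty`.
* §3 **`IsBDPLFunctionWtSigmaInt ι 𝔭 κ γ g Σ ΩK Ωp (Q : PowerSeries 𝓞_{ℂ_p})`** — VERBATIM `IsBDPLFunctionWt` with `UnrSeries.HasValueAt`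
  ↦ `IntSeries.HasValueAt` and the interpolation value of §2; API `hasValueAt`, `eq_of_hasValueAt`, and the bridges
  `isBDPLFunctionWtSigmaInt_empty_iff_isBDPLFunctionWt_of_coeff_eq` (Σ = ∅, `Q` = an `R₀`-series read in `𝓞_{ℂ_p}`: IS the D3 frame)
  and `isBDPLFunctionWtSigmaInt_empty_iff_isBDPLFunction_of_coeff_eq` (weight `2`: IS Castella's Thm. 3.1 frame).

HONEST SCOPE: characterising PREDICATES and the special values they mention; no construction of `ℒ_{𝔭,ψ}(g)`, no existence claim,
nothing about Hida families or Selmer groups; the receptacle `𝓞_{ℂ_p}⟦T⟧` is WIDER than print's `Λ_𝒪^ur` (an element of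
`(R₀·𝒪)⟦T⟧ ⊂ 𝓞_{ℂ_p}⟦T⟧` with the printed property has it here). Consumers (planned, cell memo §2): the one-newform OPEN fact F4♯
(erratum Thm. 2.3 «⊂» ⟸ [FW21, Thm. 4.41]) and the PUB congruence fact F3♯ (Cas20 Thm. 2.11 + Cas18 (4.1)).

## References

* [JetchevSkinnerWan2017] D. Jetchev, C. Skinner, X. Wan, Camb. J. Math. 5 (2017), §5.1 (arXiv:1512.06894 tex p0022 L41–50:
  `L^Σ_p(f)` and its interpolation of the incomplete value `L^Σ(f,ψ^alg,1)`).
* [Castella2018] F. Castella, Camb. J. Math. 6 (2018), Thm. 3.1 and (3.1) (arXiv:1704.06608 p. 9: `L^Σ_p(f) := L_p(f) × ∏ P_w(…)`).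
* [CastellaHsieh2018] Math. Ann. 370 (2018), §3.3 Def. 3.7 ∕ Prop. 3.8 (the weight-`2r` interpolation; D3's docstring).
* [Castella2020JIMJ] J. Inst. Math. Jussieu 19 (2020), Thm. 2.11, Rem. 2.12 (central values at weight `k`; same CM periods).
* [Castella2018Erratum] Thm. 2.3 and (2.5) (p. 3–4: the consumer's statement); tree: `BDPAnticyclotomicPAdicLFunctionHigherWeight.lean`
  (D3), `AnticyclotomicRankinSelbergPAdicLFunction.lean` (`IntSeries.HasValueAt`), `BDPAnticyclotomicPAdicLFunction.lean` (weight `2`).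
-/

noncomputable section

open scoped MatrixGroups ModularForm
open CongruenceSubgroup NumberField IsDedekindDomain Field
open Literature.NumberTheory.GaloisRepresentations
open Literature.NumberTheory.EllipticCurves.ModularForms

universe u

namespace Literature.NumberTheory.EllipticCurves

/-! ### §1. The Σ-depleted central value -/

section SigmaValue

variable {K : Type u} [Field K] [NumberField K] {M N : ℕ} {k : ℤ}

/-- **The Σ-depleted (incomplete) special value `L^Σ(g/K, φ, s₀) := L(g/K, φ, s₀) · ∏_{v ∈ Σ} L_v(g/K, φ, s₀)⁻¹`** — the value
through the continuation (`rankinSelbergValueHeckeWt`) times the inverse local factors (`rankinSelbergLocalFactorInvHeckeWt`) at the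
finite set `Σ` of finite places of `K` ("the incomplete `L`-value `L^Σ(f,ψ^alg,1)`").
[cite: JetchevSkinnerWan2017, §5.1 (arXiv:1512.06894 tex p0022 L41–50)] [cite: Castella2018, (3.1) (arXiv:1704.06608 p. 9)] -/
def rankinSelbergValueHeckeWtSigma (g : CuspForm (Gamma0 M) k) (φ : HeckeCharacter K)
    (S : Finset (HeightOneSpectrum (𝓞 K))) (s₀ : ℂ) : ℂ :=
  rankinSelbergValueHeckeWt g φ s₀ * ∏ v ∈ S, rankinSelbergLocalFactorInvHeckeWt g φ v s₀

/-- At `Σ = ∅` the Σ-depleted value is the value. [cite: JetchevSkinnerWan2017, §5.1 (arXiv:1512.06894 tex p0022 L41–50)] -/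
theorem rankinSelbergValueHeckeWtSigma_empty (g : CuspForm (Gamma0 M) k) (φ : HeckeCharacter K) (s₀ : ℂ) :
    rankinSelbergValueHeckeWtSigma g φ ∅ s₀ = rankinSelbergValueHeckeWt g φ s₀ := by
  simp [rankinSelbergValueHeckeWtSigma]

/-- Enlarging `Σ` by one place multiplies the Σ-depleted value by that inverse local factor.
[cite: JetchevSkinnerWan2017, §5.1 (arXiv:1512.06894 tex p0022 L41–50)] -/
theorem rankinSelbergValueHeckeWtSigma_insert [DecidableEq (HeightOneSpectrum (𝓞 K))] (g : CuspForm (Gamma0 M) k)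
    (φ : HeckeCharacter K) {S : Finset (HeightOneSpectrum (𝓞 K))} {v : HeightOneSpectrum (𝓞 K)} (hv : v ∉ S) (s₀ : ℂ) :
    rankinSelbergValueHeckeWtSigma g φ (insert v S) s₀ =
      rankinSelbergLocalFactorInvHeckeWt g φ v s₀ * rankinSelbergValueHeckeWtSigma g φ S s₀ := by
  simp only [rankinSelbergValueHeckeWtSigma, Finset.prod_insert hv]
  ring

end SigmaValue

/-! ### §2. The Σ-depleted interpolation value at weight `k` -/

section InterpolationSigma

variable {K : Type u} [Field K] [NumberField K] {M N : ℕ} {k : ℤ}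

/-- **The complex part of the weight-`k`, Σ-depleted interpolation value** at an unramified anticyclotomic Hecke character `φ` of
infinity type `(−n, n)`, `n ≥ k/2`: VERBATIM the tree's `bdpInterpolationValueWt` (Castella–Hsieh Prop. 3.8 in Castella's
normalisation) with the central value `L(g/K, φ, k/2)` replaced by the incomplete one `L^Σ(g/K, φ, k/2)`:
`Γ(n − k/2 + 1) Γ(n + k/2) · (1 − a_p(g) p^{−k/2} φ(𝔭) + ε_p φ(𝔭)²)² · L^Σ(g/K, φ, k/2) / (π^{2n+1} · Ω_K^{4n})`.
[cite: JetchevSkinnerWan2017, §5.1 (arXiv:1512.06894 tex p0022 L41–50)] [cite: CastellaHsieh2018, §3.3 Prop. 3.8 (publ.)]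
[cite: Castella2018, Thm. 3.1 and (3.1)] -/
def bdpInterpolationValueWtSigma (p : ℕ) (g : CuspForm (Gamma0 M) k) (𝔭 : HeightOneSpectrum (𝓞 K))
    (φ : HeckeCharacter K) (S : Finset (HeightOneSpectrum (𝓞 K))) (n : ℕ) (ΩK : ℂ) : ℂ :=
  let εp : ℂ := if p ∣ M then 0 else ((p : ℂ))⁻¹
  let φ𝔭 : ℂ := heckeValueExtZero φ 𝔭
  let r : ℤ := k / 2
  Complex.Gamma ((n : ℂ) - (r : ℂ) + 1) * Complex.Gamma ((n : ℂ) + (r : ℂ)) *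
    (1 - cuspCoeff g p * ((p : ℂ) ^ r)⁻¹ * φ𝔭 + εp * φ𝔭 ^ 2) ^ 2 *
    rankinSelbergValueHeckeWtSigma g φ S (r : ℂ) / ((Real.pi : ℂ) ^ (2 * n + 1) * ΩK ^ (4 * n))

/-- **At `Σ = ∅` the Σ-depleted interpolation value is D3's `bdpInterpolationValueWt`.**
[cite: CastellaHsieh2018, §3.3 Prop. 3.8 (publ.)] -/
theorem bdpInterpolationValueWtSigma_empty (p : ℕ) (g : CuspForm (Gamma0 M) k) (𝔭 : HeightOneSpectrum (𝓞 K))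
    (φ : HeckeCharacter K) (n : ℕ) (ΩK : ℂ) :
    bdpInterpolationValueWtSigma p g 𝔭 φ ∅ n ΩK = bdpInterpolationValueWt p g 𝔭 φ n ΩK := by
  simp only [bdpInterpolationValueWtSigma, bdpInterpolationValueWt, rankinSelbergValueHeckeWtSigma_empty]

/-- At weight `2` and `Σ = ∅` it is Castella's weight-`2` interpolation value. [cite: Castella2018, Thm. 3.1] -/
theorem bdpInterpolationValueWtSigma_empty_two (p : ℕ) (f : CuspForm (Gamma0 N) 2) (𝔭 : HeightOneSpectrum (𝓞 K))
    (φ : HeckeCharacter K) (n : ℕ) (ΩK : ℂ) :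
    bdpInterpolationValueWtSigma p f 𝔭 φ ∅ n ΩK = bdpInterpolationValue p f 𝔭 φ n ΩK := by
  rw [bdpInterpolationValueWtSigma_empty, bdpInterpolationValueWt_two]

end InterpolationSigma

/-! ### §3. The characterising predicate in `𝓞_{ℂ_p}⟦T⟧` -/

section IsBDPLFunctionWtSigmaInt

variable {K : Type u} [Field K] [NumberField K] {M N : ℕ} {k : ℤ}
variable {p : ℕ} [Fact p.Prime]

/-- **The interpolation property of the Σ-IMPRIMITIVE anticyclotomic `p`-adic `L`-function `L^Σ_p(g)` of a weight-`k` cusp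
form `g ∈ S_k(Γ₀(M))`, read in `𝓞_{ℂ_p}⟦T⟧`**: `Q ∈ 𝓞_{ℂ_p}⟦T⟧` (`1 + T ↔ γ`) satisfies — for every Hecke character `φ` of `K`
UNRAMIFIED at all finite places, of infinity type `(−n, n)` with `n ≥ k/2`, and every `p`-adic avatar `r` of `φ` factoring through
`Γ` — that its value at `T = φ̂(γ) − 1` (`IntSeries.HasValueAt`) is `ι⁻¹(bdpInterpolationValueWtSigma p g 𝔭 φ Σ n Ω_K) · Ω_p^{4n}`.
VERBATIM the tree's `IsBDPLFunctionWt` (D3) with two changes: the receptacle (`UnrSeries p` ↦ `PowerSeries 𝓞_{ℂ_p}`, values by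
`IntSeries.HasValueAt`, as in the weight-`2` shape `R1.IsBDPLFunctionInt` of the cell's Summits library) and the value
(Σ-depleted, §2; [JSW17 §5.1]: the incomplete `p`-adic `L`-function "satisfies the interpolation formula … with `L(f,ψ^alg,1)`
replaced with the incomplete `L`-value `L^Σ(f,ψ^alg,1)`"). Parameters: `ι : ℚ̄_p ≃ ℂ`, the distinguished prime `𝔭 ∣ p`, `κ`,
`γ`, `g` (meant: a `p`-ordinary newform of even weight `k ≥ 2` and level `M` prime to `p`), `Σ` (meant: finite, away from `p`),
CM periods `Ω_K ∈ ℂ`, `Ω_p ∈ ℂ_p`. A characterising PREDICATE; not a construction, not an existence claim. At `Σ = ∅` it is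
D3's frame read in `𝓞_{ℂ_p}⟦T⟧` (`isBDPLFunctionWtSigmaInt_empty_iff_isBDPLFunctionWt_of_coeff_eq`).
[cite: JetchevSkinnerWan2017, §5.1 (arXiv:1512.06894 tex p0022 L41–50)] [cite: CastellaHsieh2018, §3.3 Def. 3.7 and Prop. 3.8 (publ.)]
[cite: Castella2018, Thm. 3.1 and (3.1)] [cite: Castella2020JIMJ, Thm. 2.11 and Rem. 2.12] -/
def IsBDPLFunctionWtSigmaInt (ι : PadicAlgCl p ≃+* ℂ) (𝔭 : HeightOneSpectrum (𝓞 K)) (κ : ZpExtension K p)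
    (γ : absoluteGaloisGroup K) (g : CuspForm (Gamma0 M) k) (S : Finset (HeightOneSpectrum (𝓞 K)))
    (ΩK : ℂ) (Ωp : ℂ_[p]) (Q : PowerSeries (PadicComplexInt p)) : Prop :=
  ∀ (φ : HeckeCharacter K) (n : ℕ), k / 2 ≤ (n : ℤ) → (∀ v : HeightOneSpectrum (𝓞 K), φ.IsUnramifiedAt v) →
    φ.HasInfinityType (fun _ ↦ (n : ℤ)) (fun _ ↦ -(n : ℤ)) →
    ∀ r : FramedGaloisRep K (PadicAlgCl p) 1, IsPAdicAvatarOf ι φ r → FactorsThroughZp κ r →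
      IntSeries.HasValueAt Q (avatarValueAt r γ - 1)
        (((ι.symm (bdpInterpolationValueWtSigma p g 𝔭 φ S n ΩK) : PadicAlgCl p) : ℂ_[p]) * Ωp ^ (4 * n))

/-! #### API -/

variable {ι : PadicAlgCl p ≃+* ℂ} {𝔭 : HeightOneSpectrum (𝓞 K)} {κ : ZpExtension K p}
  {γ : absoluteGaloisGroup K} {g : CuspForm (Gamma0 M) k} {S : Finset (HeightOneSpectrum (𝓞 K))}
  {ΩK : ℂ} {Ωp : ℂ_[p]} {Q : PowerSeries (PadicComplexInt p)}

/-- Unfolding `IsBDPLFunctionWtSigmaInt` at one character: the prescribed value at `T = φ̂(γ) − 1`.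
[cite: JetchevSkinnerWan2017, §5.1 (arXiv:1512.06894 tex p0022 L41–50)] -/
theorem IsBDPLFunctionWtSigmaInt.hasValueAt (hQ : IsBDPLFunctionWtSigmaInt ι 𝔭 κ γ g S ΩK Ωp Q)
    {φ : HeckeCharacter K} {n : ℕ} (hn : k / 2 ≤ (n : ℤ))
    (hunr : ∀ v : HeightOneSpectrum (𝓞 K), φ.IsUnramifiedAt v)
    (hinf : φ.HasInfinityType (fun _ ↦ (n : ℤ)) (fun _ ↦ -(n : ℤ)))
    {r : FramedGaloisRep K (PadicAlgCl p) 1} (hr : IsPAdicAvatarOf ι φ r) (hκ : FactorsThroughZp κ r) :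
    IntSeries.HasValueAt Q (avatarValueAt r γ - 1)
      (((ι.symm (bdpInterpolationValueWtSigma p g 𝔭 φ S n ΩK) : PadicAlgCl p) : ℂ_[p]) * Ωp ^ (4 * n)) :=
  hQ φ n hn hunr hinf r hr hκ

/-- The prescribed value at a character in the range of interpolation is unique.
[cite: JetchevSkinnerWan2017, §5.1 (arXiv:1512.06894 tex p0022 L41–50)] -/
theorem IsBDPLFunctionWtSigmaInt.eq_of_hasValueAt (hQ : IsBDPLFunctionWtSigmaInt ι 𝔭 κ γ g S ΩK Ωp Q)
    {φ : HeckeCharacter K} {n : ℕ} (hn : k / 2 ≤ (n : ℤ))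
    (hunr : ∀ v : HeightOneSpectrum (𝓞 K), φ.IsUnramifiedAt v)
    (hinf : φ.HasInfinityType (fun _ ↦ (n : ℤ)) (fun _ ↦ -(n : ℤ)))
    {r : FramedGaloisRep K (PadicAlgCl p) 1} (hr : IsPAdicAvatarOf ι φ r) (hκ : FactorsThroughZp κ r)
    {v : ℂ_[p]} (hv : IntSeries.HasValueAt Q (avatarValueAt r γ - 1) v) :
    v = ((ι.symm (bdpInterpolationValueWtSigma p g 𝔭 φ S n ΩK) : PadicAlgCl p) : ℂ_[p]) * Ωp ^ (4 * n) :=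
  hv.unique (hQ.hasValueAt hn hunr hinf hr hκ)

/-- **At `Σ = ∅`, an `R₀`-series read coefficientwise in `𝓞_{ℂ_p}⟦T⟧` is a Σ-imprimitive `𝓞_{ℂ_p}`-frame iff it is D3's
weight-`k` frame** (`IntSeries.hasValueAt_iff_of_coeff_eq` + `bdpInterpolationValueWtSigma_empty`).
[cite: CastellaHsieh2018, §3.3 Prop. 3.8 (publ.)] [cite: Castella2018, §2.2 and §3 (arXiv:1704.06608 pp. 5, 9)] -/
theorem isBDPLFunctionWtSigmaInt_empty_iff_isBDPLFunctionWt_of_coeff_eq {L : UnrSeries p}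
    (h : ∀ j : ℕ, ((PowerSeries.coeff j Q : PadicComplexInt p) : ℂ_[p]) =
      ((PowerSeries.coeff j L : unrIntegers p) : ℂ_[p])) :
    IsBDPLFunctionWtSigmaInt ι 𝔭 κ γ g ∅ ΩK Ωp Q ↔ IsBDPLFunctionWt ι 𝔭 κ γ g ΩK Ωp L := by
  simp only [IsBDPLFunctionWtSigmaInt, IsBDPLFunctionWt, bdpInterpolationValueWtSigma_empty,
    IntSeries.hasValueAt_iff_of_coeff_eq h]

/-- **At weight `2` and `Σ = ∅`** the same bridge lands in Castella's Thm. 3.1 frame `IsBDPLFunction`.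
[cite: Castella2018, Thm. 3.1 (arXiv:1704.06608 p. 9)] -/
theorem isBDPLFunctionWtSigmaInt_empty_iff_isBDPLFunction_of_coeff_eq {f : CuspForm (Gamma0 N) 2}
    {L : UnrSeries p}
    (h : ∀ j : ℕ, ((PowerSeries.coeff j Q : PadicComplexInt p) : ℂ_[p]) =
      ((PowerSeries.coeff j L : unrIntegers p) : ℂ_[p])) :
    IsBDPLFunctionWtSigmaInt ι 𝔭 κ γ f ∅ ΩK Ωp Q ↔ IsBDPLFunction ι 𝔭 κ γ f ΩK Ωp L := by
  rw [isBDPLFunctionWtSigmaInt_empty_iff_isBDPLFunctionWt_of_coeff_eq h, isBDPLFunctionWt_two_iff]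

end IsBDPLFunctionWtSigmaInt

end Literature.NumberTheory.EllipticCurves

end
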